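import Literature.Analysis.Asymptotics.LinearRecurrenceDeflation
import Mathlib.Analysis.SpecialFunctions.Sqrt
import Mathlib.Analysis.SpecialFunctions.Log.Basic
import HarnessLib

/-!
# Explicit two-term asymptotics for a real third-order linear recurrence with a dominant simple root

Model-free input for UNIFORM (in a parameter) coefficient asymptotics of rational generating functions (lane «pcv-sawmu»,
DOOR-ap5-g24 item 1: the two-fugacity one-cell strip, whose parity subsequences obey a cubic recurrence with characteristic
polynomial `(t − s)(t² + pt + κ)`, `s = μ₁(y,z)²` simple and dominant).  Everything is stated with EXPLICIT constants that are
continuous functions of the data, so that uniformity on compact parameter sets is a matter of taking suprema.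

* §1 `quadRootBound p κ = max((|p| + √(p² − 4κ))/2, √κ)`: an explicit bound for the moduli of ALL complex roots of
  `σ² + pσ + κ` (`norm_le_quadRootBound`; real roots `(−p ± √D)/2`, non-real roots of modulus `√κ`), jointly continuous in
  `(p, κ)` (`continuous_quadRootBound`) — no case distinction at the discriminant.
* §2 `tsum_coe_add_one_mul_geometric`, `tsum_tail_coe_add_one_mul_geometric_le`: `Σ (n+1)θⁿ = 1/(1−θ)²` and the tail bound
  `Σ_{i} (i+n+1)θ^{i+n} ≤ (n+1)θⁿ/(1−θ)²`.
* §3 ★★ `exists_tendsto_abs_sub_le_of_rec_three`: if `b_{n+3} = A b_{n+2} + B b_{n+1} + C b_n` with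
  `t³ − At² − Bt − C = (t − s)(t² + pt + κ)`, `0 < R < s`, and every complex root of `σ² + pσ + κ` has modulus `≤ R`, then
  `b_n/sⁿ → L` for some `L` and, for EVERY `n`,
  `|b_n − L sⁿ| ≤ (|b₁ − s b₀| + |b₂ − s b₁|/R)·(n+1)·Rⁿ·s/(s − R)²`
  (deflation `g_n = b_{n+1} − s b_n` obeys the cofactor recurrence; the landed `abs_le_of_rec_two`; a telescoping sum and the
  geometric tail).
* §4 `abs_le_of_rec_two_double_root` (the double-root case `f_{n+2} = 2w f_{n+1} − w² f_n`: `|f_n| ≤ (n+1)wⁿ(|f₀| + |f₁|/w)`),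
  `abs_log_le_two_mul_of_abs_sub_one_le` (`|x − 1| ≤ δ ≤ ½ ⇒ |log x| ≤ 2δ`).

## Sources
Stanley2012EC1 §4.1 Theorem 4.1.1 (iii) (coefficients of rational functions: exponential polynomials; the poles of smallest modulus
dominate — here made quantitative with explicit constants); lane arrangement.  Nothing quoted AS PRINTED.
-/

noncomputable section

open Filter Topology Finset

namespace Literature.Analysis

/-! ## §1 An explicit continuous bound for the root moduli of a real monic quadratic -/

/-- `R(p, κ) = max((|p| + √(p² − 4κ))/2, √κ)` — a bound for the moduli of the complex roots of `σ² + pσ + κ`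
(`√` is `Real.sqrt`, `= 0` on negatives). [cite: Stanley2012EC1, §4.1 Theorem 4.1.1 (iii) (lane tool)] -/
def quadRootBound (p κ : ℝ) : ℝ := max ((|p| + Real.sqrt (p ^ 2 - 4 * κ)) / 2) (Real.sqrt κ)

/-- `R(p, κ) ≥ 0`. [cite: Stanley2012EC1, §4.1 (lane tool)] -/
theorem quadRootBound_nonneg (p κ : ℝ) : 0 ≤ quadRootBound p κ :=
  le_trans (Real.sqrt_nonneg κ) (le_max_right _ _)

/-- `√κ ≤ R(p, κ)`. [cite: Stanley2012EC1, §4.1 (lane tool)] -/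
theorem sqrt_le_quadRootBound (p κ : ℝ) : Real.sqrt κ ≤ quadRootBound p κ := le_max_right _ _

/-- `(|p| + √(p² − 4κ))/2 ≤ R(p, κ)`. [cite: Stanley2012EC1, §4.1 (lane tool)] -/
theorem half_le_quadRootBound (p κ : ℝ) : (|p| + Real.sqrt (p ^ 2 - 4 * κ)) / 2 ≤ quadRootBound p κ := le_max_left _ _

/-- ★ **Every complex root `σ` of `σ² + pσ + κ` (`p, κ` real) has `‖σ‖ ≤ R(p, κ)`**: writing `σ = a + bi`, the imaginary part of
the equation is `b(2a + p) = 0`; if `b = 0` then `(2a + p)² = p² − 4κ` and `|a| ≤ (|p| + √(p² − 4κ))/2`; if `2a + p = 0` then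
`a² + b² = κ`. [cite: Stanley2012EC1, §4.1 Theorem 4.1.1 (iii) (lane tool)] -/
theorem norm_le_quadRootBound {p κ : ℝ} {σ : ℂ} (hσ : σ ^ 2 + (p : ℂ) * σ + (κ : ℂ) = 0) :
    ‖σ‖ ≤ quadRootBound p κ := by
  set a := σ.re with ha
  set b := σ.im with hb
  have h1 := congrArg Complex.re hσ
  have h2 := congrArg Complex.im hσ
  simp only [sq, Complex.add_re, Complex.mul_re, Complex.ofReal_re, Complex.ofReal_im, Complex.zero_re,
    Complex.add_im, Complex.mul_im, Complex.zero_im, zero_mul, sub_zero, add_zero] at h1 h2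
  rw [← ha, ← hb] at h1 h2
  have hnorm : ‖σ‖ = Real.sqrt (a * a + b * b) := by rw [Complex.norm_def, Complex.normSq_apply]
  have him : b * (2 * a + p) = 0 := by linear_combination h2
  rcases mul_eq_zero.1 him with hb0 | h2a
  · -- real root
    have hre : (2 * a + p) ^ 2 = p ^ 2 - 4 * κ := by rw [hb0] at h1; nlinarith [h1]
    have hsq : Real.sqrt (p ^ 2 - 4 * κ) = |2 * a + p| := by rw [← hre, Real.sqrt_sq_eq_abs]
    have hn : ‖σ‖ = |a| := by rw [hnorm, hb0, mul_zero, add_zero, Real.sqrt_mul_self_eq_abs]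
    rw [hn]
    refine le_trans ?_ (half_le_quadRootBound p κ)
    rw [hsq]
    have : |2 * a| ≤ |2 * a + p| + |p| := by
      calc |2 * a| = |(2 * a + p) + (-p)| := by ring_nf
        _ ≤ |2 * a + p| + |-p| := abs_add_le _ _
        _ = |2 * a + p| + |p| := by rw [abs_neg]
    rw [abs_mul, abs_two] at this
    linarith
  · -- non-real (or double) root on the line `2a + p = 0`
    have hk : a * a + b * b = κ := by linear_combination a * h2a - h1
    rw [hnorm, hk]
    exact sqrt_le_quadRootBound p κ

/-- `R` is jointly continuous in `(p, κ)`. [cite: Stanley2012EC1, §4.1 (lane tool)] -/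
theorem continuous_quadRootBound : Continuous fun q : ℝ × ℝ => quadRootBound q.1 q.2 := by
  unfold quadRootBound
  fun_prop

/-- `R(p(x), κ(x))` is continuous at `x₀` when `p, κ` are. [cite: Stanley2012EC1, §4.1 (lane tool)] -/
theorem ContinuousAt.quadRootBound {X : Type*} [TopologicalSpace X] {p κ : X → ℝ} {x₀ : X}
    (hp : ContinuousAt p x₀) (hκ : ContinuousAt κ x₀) :
    ContinuousAt (fun x => Literature.Analysis.quadRootBound (p x) (κ x)) x₀ :=
  (continuous_quadRootBound.continuousAt).comp (f := fun x => (p x, κ x)) (hp.prodMk hκ)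

/-! ## §2 Geometric sums with a linear factor -/

/-- `Σ_{n ≥ 0} (n+1)θⁿ = 1/(1−θ)²` for `0 ≤ θ < 1`. [cite: Stanley2012EC1, §4.1 (lane tool)] -/
theorem tsum_coe_add_one_mul_geometric {θ : ℝ} (h0 : 0 ≤ θ) (h1 : θ < 1) :
    ∑' n : ℕ, ((n : ℝ) + 1) * θ ^ n = 1 / (1 - θ) ^ 2 := by
  have hθ : ‖θ‖ < 1 := by rwa [Real.norm_eq_abs, abs_of_nonneg h0]
  have hs1 : Summable (fun n : ℕ => (n : ℝ) * θ ^ n) := by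
    simpa using summable_pow_mul_geometric_of_norm_lt_one 1 hθ
  have hs2 : Summable (fun n : ℕ => θ ^ n) := summable_geometric_of_lt_one h0 h1
  have hsplit : (fun n : ℕ => ((n : ℝ) + 1) * θ ^ n) = fun n : ℕ => (n : ℝ) * θ ^ n + θ ^ n := by
    funext n; ring
  rw [hsplit, hs1.tsum_add hs2, tsum_coe_mul_geometric_of_norm_lt_one hθ, tsum_geometric_of_lt_one h0 h1]
  have h1' : (1 - θ) ≠ 0 := by linarith
  field_simp
  ring

/-- `(n+1)θⁿ` is summable for `0 ≤ θ < 1`. [cite: Stanley2012EC1, §4.1 (lane tool)] -/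
theorem summable_coe_add_one_mul_geometric {θ : ℝ} (h0 : 0 ≤ θ) (h1 : θ < 1) :
    Summable (fun n : ℕ => ((n : ℝ) + 1) * θ ^ n) := by
  have hθ : ‖θ‖ < 1 := by rwa [Real.norm_eq_abs, abs_of_nonneg h0]
  have hs1 : Summable (fun n : ℕ => (n : ℝ) * θ ^ n) := by
    simpa using summable_pow_mul_geometric_of_norm_lt_one 1 hθ
  have hs2 : Summable (fun n : ℕ => θ ^ n) := summable_geometric_of_lt_one h0 h1
  have hsplit : (fun n : ℕ => ((n : ℝ) + 1) * θ ^ n) = fun n : ℕ => (n : ℝ) * θ ^ n + θ ^ n := by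
    funext n; ring
  rw [hsplit]; exact hs1.add hs2

/-- **Tail bound**: `Σ_{i ≥ 0} (i+n+1)θ^{i+n} ≤ (n+1)θⁿ/(1−θ)²` for `0 ≤ θ < 1`. [cite: Stanley2012EC1, §4.1 (lane tool)] -/
theorem tsum_tail_coe_add_one_mul_geometric_le {θ : ℝ} (h0 : 0 ≤ θ) (h1 : θ < 1) (n : ℕ) :
    ∑' i : ℕ, (((i + n : ℕ) : ℝ) + 1) * θ ^ (i + n) ≤ ((n : ℝ) + 1) * θ ^ n / (1 - θ) ^ 2 := by
  have hs2 : Summable (fun i : ℕ => θ ^ i) := summable_geometric_of_lt_one h0 h1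
  have hsA := summable_coe_add_one_mul_geometric h0 h1
  have hsplit : (fun i : ℕ => (((i + n : ℕ) : ℝ) + 1) * θ ^ (i + n))
      = fun i : ℕ => θ ^ n * (((i : ℝ) + 1) * θ ^ i) + (θ ^ n * n) * θ ^ i := by
    funext i; push_cast; rw [pow_add]; ring
  rw [hsplit, (hsA.mul_left _).tsum_add (hs2.mul_left _), tsum_mul_left, tsum_mul_left,
    tsum_coe_add_one_mul_geometric h0 h1, tsum_geometric_of_lt_one h0 h1]
  have h1' : 0 < 1 - θ := by linarith
  have hθn : 0 ≤ θ ^ n := pow_nonneg h0 n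
  -- `θⁿ/(1−θ)² + n θⁿ/(1−θ) ≤ (n+1)θⁿ/(1−θ)²` since `1/(1−θ) ≤ 1/(1−θ)²`
  have hle : (1 - θ)⁻¹ ≤ 1 / (1 - θ) ^ 2 := by
    rw [one_div, inv_le_inv₀ h1' (pow_pos h1' 2)]
    nlinarith
  have hn0 : (0 : ℝ) ≤ n := n.cast_nonneg
  calc θ ^ n * (1 / (1 - θ) ^ 2) + θ ^ n * n * (1 - θ)⁻¹
      ≤ θ ^ n * (1 / (1 - θ) ^ 2) + θ ^ n * n * (1 / (1 - θ) ^ 2) := by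
        gcongr
    _ = ((n : ℝ) + 1) * θ ^ n / (1 - θ) ^ 2 := by ring

/-! ## §3 The dominant simple root of a cubic recurrence: explicit geometric remainder -/

/-- ★★ **Two-term asymptotics with explicit constants.**  Let `b_{n+3} = A b_{n+2} + B b_{n+1} + C b_n` (real), where
`t³ − At² − Bt − C = (t − s)(t² + pt + κ)`, i.e. `A = s − p`, `B = ps − κ`, `C = κs`, with `s > 0`; suppose every complex root of
`σ² + pσ + κ` has modulus `≤ R` with `0 < R < s`.  Then `b_n/sⁿ` converges to some `L`, and for EVERY `n`
`|b_n − L·sⁿ| ≤ (|b₁ − s b₀| + |b₂ − s b₁|/R) · (n+1) · Rⁿ · s/(s − R)²`.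
(Proof: `g_n = b_{n+1} − s b_n` obeys `g_{n+2} = −p g_{n+1} − κ g_n`, so `|g_n| ≤ (n+1)RⁿΓ` by `abs_le_of_rec_two`;
`b_n/sⁿ = b₀ + Σ_{k<n} g_k/s^{k+1}` and the tail is a geometric sum with a linear factor.)
[cite: Stanley2012EC1, §4.1 Theorem 4.1.1 (iii) (lane statement with explicit constants)] -/
theorem exists_tendsto_abs_sub_le_of_rec_three {A B C s p κ R : ℝ} (hs : 0 < s) (hR0 : 0 < R) (hRs : R < s)
    (hA : A = s - p) (hB : B = p * s - κ) (hC : C = κ * s)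
    (hroot : ∀ σ : ℂ, σ ^ 2 + (p : ℂ) * σ + (κ : ℂ) = 0 → ‖σ‖ ≤ R)
    (b : ℕ → ℝ) (hb : ∀ n, b (n + 3) = A * b (n + 2) + B * b (n + 1) + C * b n) :
    ∃ L : ℝ, Tendsto (fun n => b n / s ^ n) atTop (𝓝 L) ∧
      ∀ n : ℕ, |b n - L * s ^ n| ≤
        (|b 1 - s * b 0| + |b 2 - s * b 1| / R) * ((n : ℝ) + 1) * R ^ n * (s / (s - R) ^ 2) := by
  -- deflation
  set g : ℕ → ℝ := fun n => b (n + 1) - s * b n with hg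
  have hgrec : ∀ n, g (n + 2) = -p * g (n + 1) - κ * g n := by
    intro n
    simp only [hg]
    rw [show n + 2 + 1 = n + 3 by ring, hb n, hA, hB, hC]
    ring
  set Γ : ℝ := |g 0| + |g 1| / R with hΓ
  have hΓ0 : 0 ≤ Γ := by positivity
  have hgb : ∀ n, |g n| ≤ ((n : ℝ) + 1) * R ^ n * Γ := by
    intro n
    cases n with
    | zero =>
      simp only [CharP.cast_eq_zero, zero_add, pow_zero, one_mul, hΓ]
      have : 0 ≤ |g 1| / R := by positivity
      linarith
    | succ n =>
      have h := abs_le_of_rec_two hR0.le hroot hgrec n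
      have hRn : 0 ≤ R ^ n := pow_nonneg hR0.le n
      have hn0 : (0 : ℝ) ≤ n := n.cast_nonneg
      -- `R^{n+1}|g₀| + (n+1)Rⁿ(|g₁| + R|g₀|) ≤ (n+2)R^{n+1}(|g₀| + |g₁|/R)`
      have e : ((((n + 1 : ℕ) : ℝ)) + 1) * R ^ (n + 1) * Γ
          = (n + 2) * R ^ (n + 1) * |g 0| + (n + 2) * R ^ n * |g 1| := by
        rw [hΓ]; push_cast; field_simp; ring
      rw [e]
      calc |g (n + 1)| ≤ R ^ (n + 1) * |g 0| + ((n : ℝ) + 1) * R ^ n * (|g 1| + R * |g 0|) := h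
        _ ≤ (n + 2) * R ^ (n + 1) * |g 0| + (n + 2) * R ^ n * |g 1| := by
          rw [pow_succ]
          nlinarith [abs_nonneg (g 0), abs_nonneg (g 1), mul_nonneg hRn (abs_nonneg (g 1)),
            mul_nonneg (mul_nonneg hRn hR0.le) (abs_nonneg (g 0))]
  -- telescoping
  have hs0 : s ≠ 0 := hs.ne'
  set f : ℕ → ℝ := fun k => g k / s ^ (k + 1) with hf
  have htel : ∀ n, b n / s ^ n = b 0 + ∑ k ∈ range n, f k := by
    intro n
    induction n with
    | zero => simp
    | succ n ih =>
      rw [sum_range_succ, ← add_assoc, ← ih]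
      simp only [hf, hg]
      field_simp
      ring
  -- domination `|f k| ≤ (Γ/s)(k+1)θ^k`, `θ = R/s`
  set θ : ℝ := R / s with hθ
  have hθ0 : 0 ≤ θ := by positivity
  have hθ1 : θ < 1 := by rw [hθ, div_lt_one hs]; exact hRs
  have hdom : ∀ k, ‖f k‖ ≤ Γ / s * ((((k : ℕ) : ℝ) + 1) * θ ^ k) := by
    intro k
    rw [Real.norm_eq_abs]
    simp only [hf]
    rw [abs_div, abs_of_pos (pow_pos hs _)]
    have hk := hgb k
    have e : Γ / s * (((k : ℝ) + 1) * θ ^ k) = ((k : ℝ) + 1) * R ^ k * Γ / s ^ (k + 1) := by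
      rw [hθ, div_pow, pow_succ]; field_simp
    rw [e]
    exact div_le_div_of_nonneg_right hk (pow_pos hs _).le
  have hsumdom : Summable (fun k : ℕ => Γ / s * ((((k : ℕ) : ℝ) + 1) * θ ^ k)) :=
    (summable_coe_add_one_mul_geometric hθ0 hθ1).mul_left _
  have hsf : Summable f := Summable.of_norm_bounded hsumdom hdom
  set L : ℝ := b 0 + ∑' k, f k with hL
  refine ⟨L, ?_, ?_⟩
  · have h := hsf.hasSum.tendsto_sum_nat
    have h' : Tendsto (fun n => b 0 + ∑ k ∈ range n, f k) atTop (𝓝 (b 0 + ∑' k, f k)) :=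
      tendsto_const_nhds.add h
    exact h'.congr fun n => (htel n).symm
  · intro n
    have hsplit := hsf.sum_add_tsum_nat_add n
    have hdiff : b n / s ^ n - L = -∑' k, f (k + n) := by rw [htel n, hL, ← hsplit]; ring
    -- tail bound
    have hsfn : Summable (fun k : ℕ => ‖f (k + n)‖) :=
      (hsf.comp_injective (add_left_injective n)).norm
    have hsdn : Summable (fun i : ℕ => Γ / s * ((((i + n : ℕ) : ℝ) + 1) * θ ^ (i + n))) :=
      ((summable_coe_add_one_mul_geometric hθ0 hθ1).comp_injective (add_left_injective n)).mul_left _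
    have htail : |∑' k, f (k + n)| ≤ Γ / s * (((n : ℝ) + 1) * θ ^ n / (1 - θ) ^ 2) := by
      calc |∑' k, f (k + n)| = ‖∑' k, f (k + n)‖ := (Real.norm_eq_abs _).symm
        _ ≤ ∑' k, ‖f (k + n)‖ := norm_tsum_le_tsum_norm hsfn
        _ ≤ ∑' i : ℕ, Γ / s * ((((i + n : ℕ) : ℝ) + 1) * θ ^ (i + n)) :=
            Summable.tsum_le_tsum (fun i => hdom (i + n)) hsfn hsdn
        _ = Γ / s * ∑' i : ℕ, ((((i + n : ℕ) : ℝ) + 1) * θ ^ (i + n)) := tsum_mul_left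
        _ ≤ Γ / s * (((n : ℝ) + 1) * θ ^ n / (1 - θ) ^ 2) := by
            gcongr
            exact tsum_tail_coe_add_one_mul_geometric_le hθ0 hθ1 n
    -- conclude
    have hsn : 0 < s ^ n := pow_pos hs n
    have hsn0 : s ^ n ≠ 0 := pow_ne_zero n hs0
    have hkey : |b n - L * s ^ n| = s ^ n * |b n / s ^ n - L| := by
      have e : b n - L * s ^ n = s ^ n * (b n / s ^ n - L) := by field_simp
      rw [e, abs_mul, abs_of_pos hsn]
    rw [hkey, hdiff, abs_neg]
    have hθn : s ^ n * θ ^ n = R ^ n := by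
      rw [hθ, div_pow, mul_div_assoc', mul_comm, mul_div_assoc, div_self hsn0, mul_one]
    have hsR : (s - R) ≠ 0 := by linarith
    have h1θ : s * (1 - θ) ^ 2 = (s - R) ^ 2 / s := by
      rw [hθ, eq_div_iff hs0]
      field_simp
    have hfac : 1 / (s * (1 - θ) ^ 2) = s / (s - R) ^ 2 := by
      rw [h1θ, one_div_div]
    have hΓ' : Γ = |b 1 - s * b 0| + |b 2 - s * b 1| / R := by simp only [hΓ, hg]
    calc s ^ n * |∑' k, f (k + n)| ≤ s ^ n * (Γ / s * (((n : ℝ) + 1) * θ ^ n / (1 - θ) ^ 2)) := by gcongr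
      _ = Γ * ((n : ℝ) + 1) * (s ^ n * θ ^ n) * (1 / (s * (1 - θ) ^ 2)) := by rw [one_div, mul_inv]; ring
      _ = (|b 1 - s * b 0| + |b 2 - s * b 1| / R) * ((n : ℝ) + 1) * R ^ n * (s / (s - R) ^ 2) := by
          rw [hθn, hfac, hΓ']

/-! ## §4 Two small companions -/

/-- **The double-root case**: `f_{n+2} = 2w f_{n+1} − w² f_n` with `w > 0` ⇒ `|f_n| ≤ (n+1)·wⁿ·(|f₀| + |f₁|/w)`.
[cite: Stanley2012EC1, §4.1 Theorem 4.1.1 (iii) (lane tool; the landed `abs_le_of_rec_two` at `R = w`)] -/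
theorem abs_le_of_rec_two_double_root {w : ℝ} (hw : 0 < w) {f : ℕ → ℝ}
    (hf : ∀ n, f (n + 2) = 2 * w * f (n + 1) - w ^ 2 * f n) (n : ℕ) :
    |f n| ≤ ((n : ℝ) + 1) * w ^ n * (|f 0| + |f 1| / w) := by
  have hroot : ∀ σ : ℂ, σ ^ 2 + ((-(2 * w) : ℝ) : ℂ) * σ + ((w ^ 2 : ℝ) : ℂ) = 0 → ‖σ‖ ≤ w := by
    intro σ hσ
    have h : (σ - w) ^ 2 = 0 := by push_cast at hσ; linear_combination hσ
    have : σ = w := by simpa [sub_eq_zero] using pow_eq_zero_iff (n := 2) (by norm_num) |>.1 h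
    rw [this, Complex.norm_real, Real.norm_eq_abs, abs_of_pos hw]
  have hf' : ∀ n, f (n + 2) = -(-(2 * w)) * f (n + 1) - w ^ 2 * f n := by intro n; rw [hf n]; ring
  cases n with
  | zero =>
    simp only [CharP.cast_eq_zero, zero_add, pow_zero, one_mul]
    have : 0 ≤ |f 1| / w := by positivity
    linarith
  | succ n =>
    have h := abs_le_of_rec_two hw.le hroot hf' n
    have hwn : 0 ≤ w ^ n := pow_nonneg hw.le n
    have hn0 : (0 : ℝ) ≤ n := n.cast_nonneg
    have e : ((((n + 1 : ℕ) : ℝ)) + 1) * w ^ (n + 1) * (|f 0| + |f 1| / w)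
        = (n + 2) * w ^ (n + 1) * |f 0| + (n + 2) * w ^ n * |f 1| := by
      push_cast; field_simp; ring
    rw [e]
    calc |f (n + 1)| ≤ w ^ (n + 1) * |f 0| + ((n : ℝ) + 1) * w ^ n * (|f 1| + w * |f 0|) := h
      _ ≤ (n + 2) * w ^ (n + 1) * |f 0| + (n + 2) * w ^ n * |f 1| := by
        rw [pow_succ]
        nlinarith [abs_nonneg (f 0), abs_nonneg (f 1), mul_nonneg hwn (abs_nonneg (f 1)),
          mul_nonneg (mul_nonneg hwn hw.le) (abs_nonneg (f 0))]

/-- `|x − 1| ≤ δ ≤ ½ ⇒ |log x| ≤ 2δ` (from `1 − 1/x ≤ log x ≤ x − 1`). [cite: Stanley2012EC1, §4.1 (lane tool)] -/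
theorem abs_log_le_two_mul_of_abs_sub_one_le {x δ : ℝ} (hδ : δ ≤ 1 / 2) (h : |x - 1| ≤ δ) :
    |Real.log x| ≤ 2 * δ := by
  obtain ⟨h1, h2⟩ := abs_le.1 h
  have hx : 1 / 2 ≤ x := by linarith
  have hx0 : 0 < x := by linarith
  rw [abs_le]
  constructor
  · -- lower: `log x ≥ 1 − 1/x ≥ −2δ`
    have hl := Real.one_sub_inv_le_log_of_pos hx0
    have : -(2 * δ) ≤ 1 - x⁻¹ := by
      rw [show (1 : ℝ) - x⁻¹ = (x - 1) / x by field_simp]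
      rw [le_div_iff₀ hx0]
      nlinarith
    linarith
  · have := Real.log_le_sub_one_of_pos hx0
    linarith

end Literature.Analysis
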